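import Mathlib
import HarnessLib
import HarnessLib.Audit
import Summits.AtomisticToContinuum.Statement
import Literature.MathematicalPhysics.StatisticalMechanics.BarlowStacking
import Literature.MathematicalPhysics.StatisticalMechanics.LennardJonesClusters
import Summits.AtomisticToContinuum.Crystallization.Theorems.LaminarSixThreeThreeBarlowToHcpWindows
import Summits.AtomisticToContinuum.Crystallization.Theorems.LaminarSixThreeThreeHcpWindowsToPeriodicWindows
import Summits.AtomisticToContinuum.Crystallization.Theorems.PhononSlackCertificatesWindowOptimality
import Summits.AtomisticToContinuum.Crystallization.Theorems.ReggeStarCoercivityDefectFreeCrystallizesHullCriterion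
import Summits.AtomisticToContinuum.Crystallization.Theorems.ExcessDecayLiouvilleCrysEnergyLimit
import HarnessLib.Audit.Status.Attr

/-!
Route: SquareWellLayerCake

DORMANT since 2026-08-26T07:17:24Z (reconciler: no traction for 8.4 d (last activity item-evidence-added at 2026-08-17T21:29:40Z); parked, not closed — `ledger route dormant route-AtomisticToContinuum-SquareWellLayerCake --off` to react) — unstaffed, not closed; items shared with open routes are served there. `ledger route dormant <id> --off` reactivates.

# Route SquareWellLayerCake — LJ beyond its minimum is a positive mixture of square wells — twelve
on average up to 1.14 makes the first zone exact; twelve-within-one and gap rigidity give Barlow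
windows

LAYER CAKE (card square-well-mixture-averaged-kissing, mechanism critic: new-mechanism): writing
V_LJ(r) = −∫_r^∞ V_LJ′ and V_LJ′ > 0
beyond the minimum r = 1, the attractive part of the energy of ANY finite configuration is −∫_1^∞
V_LJ′(t)·P(t) dt with P(t) = #{pairs at
distance ≤ t} — beyond its minimum Lennard-Jones is a positive mixture of square wells, so the FIRST
ZONE (1, 1.1] is governed exactly by
cumulative pair counts. It suffices to show X = K1 ∧ K2 ∧ K3 ∧ K4: K1 = AveragedTwelve (TWELVE ON
AVERAGE UP TO 1.14, potential-free: in
any finite point set with pairwise distances ≥ d the average number of other points within 1.14·d is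
≤ 12; conjectured sharp threshold
2/√3 = 1.1547 where bcc first averages 14); K2 = TwelveWithinOne (LJ ground states: all but o(N)
particles have ≥ 12 neighbours within
distance 1 and every particle within 1.1 of them is 55/57-separated from all others — the one-sided,
under-coordination half that the
energy must pay for); K3 = GapTwelveToBarlow (for ground states, a.e. [exactly 12 within 1, none in
(1, 1.1], separated] ⇒ a.e.
Barlow windows); K4 = StackingFaultSparsity (shared with LaminarSixThreeThree, stmt-14296). K1 ∧ K2
give "exactly twelve within one
and an EMPTY shell (1, 1.1]" a.e. by a thirteen-line count (PROVED inside `closes`); K3 gives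
LaminarBarlowWindows; the downstream to
both conjuncts is PROVED in tree (barlowToHcpWindows_proof, hcpWindowsToPeriodicWindows_proof,
stub_hullCriterion,
windowOptimality_proof, crysEnergyLimit_proof), so `closes : K1 → K2 → K3 → K4 →
_root_.Crystallization` is sorry-free TODAY.
Lean: `AveragedTwelve ∧ TwelveWithinOne ∧ GapTwelveToBarlow ∧ StackingFaultSparsity`

## Assembly
Proved sorry-free as the deciding theorem `closes (hK1 : AveragedTwelve) (hK2 : TwelveWithinOne)
(hK3 : GapTwelveToBarlow) (hS :
StackingFaultSparsity) : _root_.Crystallization` (folder SketchGlue.lean / glue.lean, lean check rc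
0, axioms propext, Classical.choice,
Quot.sound): (1) COUNT — per N, with Pre i = [separated neighbourhood ∧ ≥ 12 within 1], Good i =
[separated neighbourhood ∧ = 12 within
1 ∧ ≤ 12 within 1.1]: ¬Good ⊆ ¬Pre ∪ (Pre ∧ ≥ 13 within 1.1); summing the 1.1-counts over Pre-sites,
K1 on the 55/57-separated
sites (d = 55/57, ρ = 11/10 = 1.14·d) bounds the sum by 12·#separated ≤ 12(#Pre + #¬Pre) while each
Pre-site contributes ≥ 12 and each
offender ≥ 13, so #¬Good ≤ 13·#¬Pre and K2's Tendsto passes by squeeze_zero; (2) K3 turns this into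
LaminarSixThreeThree.LaminarBarlowWindows
(definitional unfolding); (3) barlowToHcpWindows_proof (+ K4) and hcpWindowsToPeriodicWindows_proof
give, for every ground-state
sequence, ONE periodic P matched frequently at every scale; stub_hullCriterion gives IsCrystallizing
lennardJones 3; (4) for the sequence
of ground states from LennardJonesGroundStatesExist_holds, windowOptimality_proof makes its P a
least-energy periodic configuration,
IsLeast.csInf_eq identifies ⨅ with e(P) and crysEnergyLimit_proof is then E(N)/N → e(P):
HasPeriodicGroundStateEnergy. The pair is
_root_.Crystallization. The Assembly item restates the four-crux implication and is provable by the
same term.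

Rationale: WHY THIS LINE. One integration by parts (the layer-cake representation, LiebLoss2001 Thm 1.13,
pointed at a pair sum) turns the flat well of (12,6) —
the zone [1, 1.15] where thirteen to sixteen neighbours fit around ONE centre (Tammes radii
1.0456/1.0709/1.108/1.1356,
MusinTarasov2012, doi:10.1080/10586458.2015.1022842) and every one-centre inequality fails (card
margin-map-one-centre-traps) — into an
AVERAGED, potential-free packing question of tolerant Newton–Gregory type, whose only relatives in
print are average kissing numbers of
UNEQUAL balls (doi:10.4310/mrl.1994.v1.n3.a5, arXiv:1707.02526) and Bezdek–Lángi's open soft-density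
problem below 2/√3 − 1
(arXiv:1409.4508 Problem 1, arXiv:2310.04574 Problem 2); imported areas: real-analysis layer cake +
discrete geometry of tolerant
kissing configurations (Tammes/contact numbers, Bezdek2012) + the tree's Barlow/stacking/hull
machinery. What it does that the 35 open
routes do not: over-coordination is excluded by ONE centre-averaged indicator-weight theorem
attained by every Barlow packing (no
universality or hcp-optimality claim as in HcpThetaUniversality, no one-centre two-shell bound as in
VdwKissingSutherland, no transfer or
LP certificate), the energy is asked only the ONE-SIDED statement K2 (under-coordination and
compression have density zero), and the gap
(1, 1.1] that every kissing-to-Barlow kernel needs comes for free from K1's radius instead of being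
paid on the energy side at tolerance
1/400 (BrittleRungDescent); the negatives index (EffectiveLocalHales at 1 %, OneGrainGluing) is
steered around because no pointwise
shell classification at fixed tolerance is asserted — K3 is an a.e. statement for minimisers.

RANKED CRUXES. #2 AveragedTwelve (crux) — TWELVE ON AVERAGE UP TO 1.14 (card K1 = CONJ-A at the
ratio the assembly needs): for every finite indexed configuration x, every index set G on which
pairwise distances are ≥ d > 0, and every ρ ≤ (57/50)·d, the sum over i ∈ G of the number of j ∈ G,
j ≠ i, with dist(x i, x j) ≤ ρ is at most 12·|G| (the averaged tolerant Newton–Gregory number is 12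
up to ratio 1.14; conjectured sharp threshold 2/√3 = 1.1547, where bcc averages 14; Barlow packings
and β-Mn give equality). [difficulty: XL] (why it might fail: locally 13/14/15/16 points fit within
ratios 1.0456/1.0709/1.108/1.1356 (Tammes), so a periodic net of self-supporting Z13/Z14 sites could
average > 12 below 1.14; unequal balls do exceed 12 on average (Kuperberg–Schramm 12.56); only ratio
< 1.0456 is a theorem.) [MusinTarasov2012, doi:10.1080/10586458.2015.1022842,
doi:10.4310/mrl.1994.v1.n3.a5, arXiv:1707.02526, arXiv:1409.4508, arXiv:2310.04574, Bezdek2012]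
#3 GapTwelveToBarlow (crux) — GAP-TWELVE RIGIDITY FOR MINIMISERS (card K3, typed at the delivered
tolerance): for every sequence of Lennard-Jones ground states in which the fraction of particles i
failing [every particle within 1.1 of x_i (x_i included) is 55/57-separated from all others ∧
exactly 12 particles within distance 1 of x_i ∧ at most 12 within 1.1] tends to 0, for every radius
R and tolerance ε ∈ (0, 1/4) the fraction of particles whose R-window is not two-way ε-matched,
after a linear isometry, to a window of SOME Barlow stacking barlowStacking a h s (a, h ∈ (1/2, 2),
any Hägg word s) tends to 0 (bond window [0.9649, 1] = ±1.8 %, empty shell (1, 1.1] = ratio 1.14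
over the core scale). [difficulty: XL] (why it might fail: the ±1.8 % bond window admits the
decahedral D5h shell (closes at 0.67 %); if negative ring words (4,1)/(1,3) close below ~2 %,
periodic all-twelve non-Barlow nets exist; minimiser strain must be o(1) at every window scale (no
rate); BoroczkySzabo2016 unread.) [Hales2012, BoroczkySzabo2015, BoroczkySzabo2016,
FlatleyTheil2015, Literature.Barriers.AtomisticToContinuum.DecahedralSoftShell, DoyeCalvo2002]
#4 TwelveWithinOne (crux) — TWELVE WITHIN ONE, a.e. (card K2 in its consumable one-sided form): for
every sequence of Lennard-Jones ground states the fraction of particles i failing [every particle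
within distance 1.1 of x_i (x_i included) has all its other distances ≥ 55/57 ∧ at least 12
particles j ≠ i with dist(x_i, x_j) ≤ 1] tends to 0. Mechanism: layer cake ⇒ the first-zone energy
is −∫_1^(1.1) V′P exactly, K1 removes all slack above 6N pairs, so a first-zone deficit can only be
subsidised by compression or tail (bcc: deficit 0.056 vs tail gain 0.031 per site); the per-site
form then follows from the average by the Tammes-13 cap at ratio 1/0.9649 = 1.0364 < 1.0456.
[difficulty: XL] (why it might fail: fails iff LJ bulk ground states carry a positive density of
sites with ≤ 11 neighbours within 1 or a bond < 55/57 = 0.9649 nearby (a* = 0.9712: margin 0.65 %);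
'tail cannot subsidise a first-zone deficit' is uncertified (bcc ratio 0.55); average ⇒ per-site
needs computer-assisted Tammes-13.) [BlancLewin2015, Blanc2004, Xue1997, MusinTarasov2012,
Stillinger2001, LiebLoss2001, SchwerdtfegerBurrowsSmits2021]
#5 StackingFaultSparsity (crux) — STACKING-FAULT SPARSITY (shared verbatim with route
LaminarSixThreeThree, stmt-AtomisticToContinuum-14296): for all R > 0, ε ∈ (0, 1/4) and every
sequence of LJ ground states, the fraction of particles whose R-window is (R, ε)-matched to SOME
Barlow stacking but to NO hcpStacking a h (a, h ∈ (1/2, 2), after a rigid motion) tends to 0 — the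
delegated 1-D stacking-selection step (Hägg domination against the O(N^(2/3)) surface budget).
[deps: GapTwelveToBarlow] [difficulty: XL] (why it might fail: needs hcp to beat every stacking
extensively (Hägg domination |J₂| > Σ k|J_k|, J₂ ≈ −7e−5, uncertified) and faults not to buy
surface-shape gains up to N ~ (δ_surf/|J₂|)³; an fcc-, long-period- or aperiodic-optimal LJ stacking
kills it.) [Stillinger2001, SchwerdtfegerBurrowsSmits2021, FlatleyTheil2015, BlancLewin2015]
#9 LaminarBarlowWindows (support) — BARLOW WINDOWS a.e. (the X of route LaminarSixThreeThree,
stmt-AtomisticToContinuum-14292, derived here from AveragedTwelve ∧ TwelveWithinOne ∧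
GapTwelveToBarlow by the count proved inside `closes`): for all R, ε ∈ (0, 1/4), in every sequence
of LJ ground states all but o(N) particles have their R-window two-way ε-matched, after a rigid
motion, to a window of some Barlow stacking. [difficulty: M] [BlancLewin2015, Hales2012]
#9 FirstZoneExact (support, PROVED 2026-08-16: firstZoneExact_proof) — FIRST ZONE EXACT (card P1):
AveragedTwelve implies that for every finite configuration and every index set G with pairwise
distances ≥ 55/57 the clipped first-zone energy Σ over pairs i < j in G at distance ≤ 1.1 of
[V_LJ(max(r_ij, 1)) − V_LJ(1.1)] is at least 6·|G|·(V_LJ(1) − V_LJ(1.1)) — twelve saturated bonds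
per particle is the floor of the first zone, with equality iff exactly 6|G| pairs all at r ≤ 1 (each
term ≥ V(1) − V(1.1) = −0.0158 by monotonicity of V_LJ on [1, ∞), at most 6|G| terms by
AveragedTwelve at ρ = 1.1, d = 55/57). [difficulty: provable-now] [LiebLoss2001, BlancLewin2015]
#9 AveragedTwelveRung (support, judge-repair 2026-08-17) — LADDER RUNG OF K1 AT RATIO 17/16 =
1.0625: AveragedTwelve verbatim with 57/50 replaced by 17/16, the first dyadic ratio beyond the
one-centre theorem (Tammes-13, R₁₃ = 1.04557) and below the Tammes-14 radius R₁₄ = 1.07082, so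
pointwise at most 13 neighbours fit (radial bound cos θ ≤ 1 − 1/(2r²)) and the statement reads
exactly '#Z13 sites ≤ total deficit Σ(12 − Z)₊'. A special case of the crux (AveragedTwelve →
AveragedTwelveRung, one line, folder Sketch.lean rc 0), NOT consumed by `closes` (K1 is applied
once, at d = 55/57, ρ = 11/10, ratio 57/50): it is the tractability evidence the 06:45Z judge asked
for ('a proof of AveragedTwelve at any ratio > 1.06') and the first rung of the KILL-CRITERIA pivot;
its refutation closes the route outright. Attack: radius-1 discharging — refuted at 57/50
(Negative/StarLocal: a Z14 centre with all 14 neighbours ≥ 12) — is OPEN here, where the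
over-coordinated alphabet is {Z13} with 1.6 % slack: (i) finite certificate 'a Z13 centre at ratio
17/16 has a 17/16-neighbour of degree ≤ 11' by interval arithmetic over the near-rigid Tammes-13
family (MusinTarasov2012, doi:10.1080/10586458.2015.1022842), (ii) bounded fan-in matching Z13 →
deficient neighbours; or the lead's cell-charge residual (Lines/Sketch.lean, stub_cellChargeSep)
specialised to ρ ≤ 17/16·d < √5/2·d, where every near lens holds ≤ 5 points (lens_five).
[difficulty: L]

TWO-LAYER PLAN. (revised 2026-08-17 after the disprover's Negative lemmas.) AveragedTwelve: the plan
filed at open — OneCentreRung (ratio < 1.0456, Tammes) → CompensationLemma (every Z ≥ 13 site forces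
Σ(12 − Z)₊ ≥ Σ(Z − 12)₊ among its 1.14-neighbours) — is DEAD: the radius-1 star form and the weak
compensation form are false at 57/50 (Theorems/AveragedTwelve/Negative/StarLocal.lean: 55-point
integer witness, a Z14 centre all of whose 14 neighbours have ≥ 12, kernel `decide`), radius-2 ball
averaging is false too (Negative/BallTwo.lean: 151 points, a 55-site 2-ball summing to 668 > 660),
radius 3 was not reached by the search (best −261), the pointwise cap 15 is false
(Negative/PointwiseSixteen.lean) and the constant is tight at 2/√3 (Negative/RatioTightBcc.lean,
941-point bcc ball, native_decide). The LIVE decomposition is the registered line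
Cruxes/AveragedTwelve/Lines/Sketch.lean (idea par-five-delaunay-recount): ghost frame + Delaunay
triangulation + solid-angle/dihedral partitions of unity + Girard give the Euler link recount
deg_ρ(v) − 12 = Σ_near(t_e − 5) + Σ_far(t_e − 6) with no topology; 13 stubs LANDED
(Theorems/SquareWellLayerCakeAveragedTwelve*.lean: GhostFrame, FrameSep, VertexFlat, EdgeFlat,
GirardCell, LensSix, LensPin, Assemble/AssembleSep, TetGauge, TwoCells, EdgeValence, QrRange,
AllNear, NearTriangle/NearSimplex); the one open stub `stub_cellChargeSep` (total Delaunay cell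
charge ≤ 0 on separated far frames, weights 6 far / 5 near) is EQUIVALENT to the crux, balances
fcc/hcp/every Barlow stacking exactly under the face rule R*, and needs a transport of radius ≥ 3 or
the structural rod lemma (all-near alphabet at 57/50 = {Z12, Z14, Z15}; z-periodic Z14 rods cannot
keep their rings at 12, ~130 runs, rods_and_onions.md on the item). Beside it, the RATIO LADDER:
rung 17/16 (item AveragedTwelveRung, Z13-only regime, radius-1 discharging plausible), rung 11/10 (<
√5/2 = 1.118: lens capacity 5, polytetrahedral order exactly at par — the lead's own 'rung 1'), rung
57/50 (the crux). TwelveWithinOne ⇐ FirstZoneDeficitVanishes (average form: ∫_1^(1.1) V′·(6M − P) =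
o(N) for ground states, by 'tail cannot subsidise') → TammesCap (13 points pairwise ≥ 1 in the shell
[1, 1.04] are impossible: radial projection + MusinTarasov2012) → TwelveWithinOne. GapTwelveToBarlow
⇐ StrainVanishes (minimiser elasticity: a.e. window affinely close ⇒ isometrically close) →
FiveRingSparsity (all-Good nets are Barlow off a zero-density set; signed-frustration /
Böröczky–Szabó territory) → GapTwelveToBarlow (registered skeleton 2c2bc83d1a6c, 4 stubs). k ≤ 3,
depth 1 each.

KILL CRITERIA. AveragedTwelve is used by `closes` exactly once, at d = 55/57, ρ = 11/10 (ratio 57/50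
= 1.14), so the route's fate is a function of the LARGEST witness-free ratio r*: (a) a certified
finite witness (integer coordinates through Negative/LoadBearing.not_averagedTwelveAt_of_intConfig)
with average > 12 at ratio ≤ 17/16 = 1.0625 refutes AveragedTwelveRung and AveragedTwelve together —
close `refuted:AveragedTwelve` (no shell thinner than (1, 1.0625·55/57 = 1.025] can carry K3); (b) a
witness at ratio r ∈ (17/16, 57/50] refutes AveragedTwelve but the route is REPAIRED in one edit:
restate K1 at a witness-free ratio r′ < r (new item, the refuted decl stays as a negative edge) and
restate K2/K3 with the empty shell (1, 11/10] shrunk to (1, r′·55/57] (K2 gets weaker, K3 stronger;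
same thirteen-line count in `closes`); (c) a PROOF of AveragedTwelveRung is the judge's tractability
evidence and changes nothing in the glue. A periodic all-Good non-Barlow net with certified LJ
energy within o(1) of e* per particle makes GapTwelveToBarlow hopeless — pivot to the affine-window
variant through ExcessDecayLiouville's LimitGlue or close. TwelveWithinOne refuted (positive density
of under-coordinated or 0.9649-compressed sites in ground states) means the first-zone picture of
(12,6) is wrong: close outright. StackingFaultSparsity refuted (shared with LaminarSixThreeThree):
pivot with it to the polytype-agnostic hinge BulkDefectVanishBased. LaminarBarlowWindows proved
elsewhere (LaminarSixThreeThree) moots K1–K3 for the summit but not as theorems.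

NOT DECOMPOSED YET. The transport rule of radius ≥ 3 / rod lemma that would close
`stub_cellChargeSep` (children of that stub are filed by the lead with `--supports`, never as route
items); the Z13-star certificate behind AveragedTwelveRung (interval arithmetic on the Tammes-13
family at slack 1.6 %); the coercivity constant behind TwelveWithinOne (bcc deficit/tail ratio 0.55,
shear modes O(1)) and its compression half; the vendoring of Tammes-13/14 (MusinTarasov2012,
doi:10.1080/10586458.2015.1022842, computer-assisted; cite request) — deliberately kept OUT of the
glue by the one-sided design of K2; the strain lemma and the five-ring sparsity inside K3. All are
layer-2 children or stub supports.

CHEAPEST FALSIFIER. RUN AND SURVIVED (evidence on stmt-AtomisticToContinuum-15806): kit j019115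
(route-review refuter: 1024 box-L-BFGS relaxations — random cells m = 1..14, near-bcc supercells
2..24 atoms, FK prototypes A15/Zr4Al3/C14/C15/σ/β-Mn with free coordinates — best average at every t
< 2/√3 is 12.000 exactly, 0 flags; bcc control 14 at t = 1.16), kit j020560/j020670 (disprover: TCP
minimal-spread table A15 1.2247, σ 1.2148, C15 1.2171, Zr4Al3 1.2304, C14 1.2758, α-Mn 1.1702, β-Mn
1.1223 as a 12-net — no FK topology realisable below spread 1.21; 39/40 validation starts reach
12.000 at 1.14), analytic scans (octahedron-squash 13th contact completes exactly at 2/√3; ω↔bcc,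
Burgers, Bain/bct, β-Mn(x,y) families saturate at 12.000 below 2/√3), tightness at 2/√3 certified in
Lean (RatioTightBcc). Every witness search at 1.14 covers all smaller ratios (counts are monotone in
ρ), so 'a certified witness below 1.06' has been looked for and not found. NEXT CHEAPEST: (i) for
AveragedTwelveRung — maximise the minimum 17/16-degree of the 13 neighbours of a Z13 centre (one kit
job over the Tammes-13 family; if some arrangement keeps all 13 at ≥ 12, radius-1 discharging is
dead at 17/16 too and the rung needs the cell-charge line); (ii) for AveragedTwelve — periodic
Z14-rod crystals and radius-3 balls (disprover's rods_and_onions.md: the Z14 excess is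
compensation-free to graph radius 2, not 3; the motif does not propagate along a rod).

NUMBERS. a*(fcc) = 0.971234, a*(hcp) = 0.971228, e(hcp) = −0.717589 < e(fcc) = −0.717517 < e(bcc) =
−0.686400 (Blanc–Lewin units, lattice sums
L₆/L₁₂ = 14.4539/12.1319 fcc, 14.4549/12.1323 hcp); core scale s = 55/57 = 0.964912 (margin to a*:
0.65 %); r₀/s = 57/55 = 1.03636 <
R₁₃ = 1.045573 (Tammes-13 angle 57.1367°, MusinTarasov2012; chord-1 angle on the radius-1.04 sphere
57.471°); ρ/s = 1.14 < 2/√3 = 1.154701;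
first-zone depth V(1) − V(1.1) = −0.015807 per pair, V(1.1547) − V(1) = 0.02785; Tammes radii R₁₄ =
1.07082, R₁₅ ≈ 1.1078, R₁₆ ≈ 1.1356;
bcc relaxed: 8 @ 0.9519, 6 @ 1.0991. Items at open: 7 (4 cruxes, assembly, 2 supports). Ladder: R₁₃
= 1/(2 sin(57.1367°/2)) = 1.045573 < 17/16 = 1.0625 < R₁₄ = 1/(2 sin(55.6706°/2)) = 1.07082 < 11/10
< √5/2 = 1.118034 < 57/50 = 1.14 < 2/√3 = 1.154701; shell radii in LJ units (× 55/57): 1.0252 /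
1.0614 / 1.1. Items after this edit: 8 (4 cruxes, assembly, 3 supports; FirstZoneExact and Assembly
proved).

DEFINITION REQUESTS. None (all predicates inlined over Mathlib + BarlowStacking). Cite fact wanted
(filed after open): MusinTarasov2012 — Tammes N = 13 optimum
57.1367° as a Literature named fact (needed by the layer-2 child TammesCap of TwelveWithinOne, NOT
by the glue). Acquisition: BoroczkySzabo2016
(acq-00697, cite-only) for GapTwelveToBarlow.

Novelty: Searches (2026-08-16; local searchd DOWN all session — `lit search` rc 1 ConnectionReset ×6;
OpenAlex HTTP 429; arXiv/zbMATH cascade 0 rows):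
crossref "average kissing number sphere packings tolerance" (8: Kuperberg–Schramm 1994,
Conway–Sloane, Hales 2013), crossref "soft density sphere
packings Bezdek Langi" (8: Bezdek contact-number papers, doi:10.1112/mtk.12102), crossref "contact
numbers unit sphere packings upper bound" (6),
crossref "strong thirteen spheres problem Musin Tarasov" (6: doi:10.1007/s00454-011-9392-2),
crossref "Tammes problem for N=14" (6), crossref
"twelve neighbour packings unit balls Boroczky Szabo" (6: doi:10.1007/s10474-016-0583-4 FOUND —
ε-quasi-twelve-neighbour packings, paywalled,
acq-00697), crossref "square-well solid ground state structure …" (8, thermodynamics only); `lit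
galaxy search "square-well solid" --star all` (0),
`… "quasi-twelve-neighbour" --star all` (0), galaxy bm25 pdf "square well potential bcc fcc ground
state" (12, physics noise); tree greps
(Theses/*.lean of the 35 open routes for layer-cake / cumulative pair count / average kissing: 0);
plus the card's 2026-08-15 searches and the
mechanism critic's independent legs (2026-08-16T00:34Z, grade new-mechanism).
Nearest prior art found: arXiv:2310.04574 (Bezdek–Lángi 2024, Problem 2 / Thm 3: SOFT overlap-volume
density, fcc a local max among lattices)
and arXiv:1409.4508 (Problem 1, the λ < 2/√3 − 1 regime named, non-sharp Rogers-type bounds);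
doi:10.4310/mrl.1994.v1.n3.a5 + arXiv:1  [refs: 10.1112/mtk.12102, 10.1007/s00454-011-9392-2, 10.1007/s10474-016-0583-4, 10.4310/mrl.1994.v1.n3.a5, 2310.04574, 1409.4508, 1707.02526, doi:10.1112/mtk.12102, doi:10.1007/s00454-011-9392-2, doi:10.1007/s10474-016-0583-4, doi:10.4310/mrl.1994.v1.n3.a5, MusinTarasov2012, BoroczkySzabo2016, LiebLoss2001]

Barriers (technique_class: layer-cake-square-wells, averaged-kissing, gap-rigidity): - technique_class: layer-cake-square-wells, averaged-kissing, gap-rigidity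
- Literature.Barriers.AtomisticToContinuum.TetrahedralFrustration: evaded in the first zone —
AveragedTwelve is an average over centres at fixed radius, outside the per-cell / per-centre density
class the barrier kills (locally 16 fit, on average conjecturally 12); it re-enters honestly inside
TwelveWithinOne's coercivity (tail vs deficit, few-% accuracy) and GapTwelveToBarlow.
- Literature.Barriers.AtomisticToContinuum.FlexibleKissingArrangements: no inference from one
shell's shape; a.e.-twelve comes from a global count plus a one-sided energetic statement, and K3 is
an a.e. statement for minimisers.
- Literature.Barriers.AtomisticToContinuum.IcosahedralClusters: finite icosahedral/Mackay ground
states have zero density; the icosahedral shell needs 5 % bond spread, outside the delivered window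
[0.9649, 1], so it is not 'Good' and is charged to TwelveWithinOne's energy.
- Literature.Barriers.AtomisticToContinuum.DecahedralSoftShell: it does; the bet is that five-ring
axes have zero density in minimisers and that periodic all-twelve non-Barlow nets do not exist at
±1.8 % with an empty shell to 1.1 (GapTwelveToBarlow's why-might-fail names it).
- Literature.Barriers.AtomisticToContinuum.KissingTwelveDegeneracy: respected — twelve contacts
select no stacking; selection is the shared crux StackingFaultSparsity.
- Literature.Barriers.AtomisticToContinuum.ShortRangeStackingBlindness: untouched by K1–K3 by d

History (route lifecycle, newest last):
- 2026-08-26T07:17:24Z · DORMANT — reconciler: no traction for 8.4 d (last activity item-evidence-added at 2026-08-17T21:29:40Z); parked, not closed — `ledger route dormant route-AtomisticToConti (operator:999:3757261)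

sub-problem: Crystallization · status: dormant · opened planner-plan-novel-AtomisticToContinuum-Crystal-ad211d65-v2-0 2026-08-16T15:59:31Z · rev 3 · ledger route-AtomisticToContinuum-SquareWellLayerCake
GENERATED by the gate from the ledger (D-0016/17). Provers cite these decls: `theorem foo : Summit.AtomisticToContinuum.Crystallization.Theses.SquareWellLayerCake.<Decl> := …` in Summits/AtomisticToContinuum/Crystallization/Theorems/<Name>.lean.
-/

namespace Summit.AtomisticToContinuum.Crystallization.Theses.SquareWellLayerCake

open scoped BigOperators Topology Manifold Classical MeasureTheory ProbabilityTheory Matrix InnerProductSpace ComplexConjugate ContinuousMap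
open Filter Set Function TopologicalSpace MeasureTheory

attribute [summit_statement] _root_.Crystallization

/-- item stmt-AtomisticToContinuum-15806 · crux · rank 2 · open · by planner
why it might fail: a periodic net whose Z14/Z15 sites (all-near alphabet at 57/50) outnumber its deficits would average > 12 below 1.14: radius-1 star and radius-2 ball averaging are already FALSE at 57/50 (Negative/StarLocal, BallTwo), constant tight at 2/√3 (RatioTightBcc); only ratio < 1.0456 is a theorem.
sources: MusinTarasov2012, doi:10.1080/10586458.2015.1022842, doi:10.4310/mrl.1994.v1.n3.a5, arXiv:1707.02526, arXiv:1409.4508, arXiv:2310.04574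
[crux] TWELVE ON AVERAGE UP TO 1.14 (card K1 = CONJ-A at the ratio the assembly needs): for every
finite indexed configuration x, every index set G on which pairwise distances are ≥ d > 0, and every
ρ ≤ (57/50)·d, the sum over i ∈ G of the number of j ∈ G, j ≠ i, with dist(x i, x j) ≤ ρ is at most
12·|G| (the averaged tolerant Newton–Gregory number is 12 up to ratio 1.14; conjectured sharp
threshold 2/√3 = 1.1547, where bcc averages 14; Barlow packings and β-Mn give equality).
[difficulty: XL] -/
@[route_item "route-AtomisticToContinuum-SquareWellLayerCake", crux]
def AveragedTwelve : Prop :=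
  ∀ (N : ℕ) (x : Fin N → EuclideanSpace ℝ (Fin 3)) (G : Finset (Fin N)) (d ρ : ℝ), 0 < d → ρ ≤ 57 / 50 * d → (∀ i ∈ G, ∀ j ∈ G, i ≠ j → d ≤ dist (x i) (x j)) → (∑ i ∈ G, ((G.filter fun j => j ≠ i ∧ dist (x i) (x j) ≤ ρ).card : ℝ)) ≤ 12 * G.card

/-- item stmt-AtomisticToContinuum-15807 · crux · rank 3 · open · by planner
why it might fail: the ±1.8 % bond window admits the decahedral D5h shell (closes at 0.67 %); if negative ring words (4,1)/(1,3) close below ~2 %, periodic all-twelve non-Barlow nets exist; minimiser strain must be o(1) at every window scale (no rate); BoroczkySzabo2016 unread.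
sources: Hales2012, BoroczkySzabo2015, BoroczkySzabo2016, FlatleyTheil2015, Literature.Barriers.AtomisticToContinuum.DecahedralSoftShell, DoyeCalvo2002
[crux] GAP-TWELVE RIGIDITY FOR MINIMISERS (card K3, typed at the delivered tolerance): for every
sequence of Lennard-Jones ground states in which the fraction of particles i failing [every particle
within 1.1 of x_i (x_i included) is 55/57-separated from all others ∧ exactly 12 particles within
distance 1 of x_i ∧ at most 12 within 1.1] tends to 0, for every radius R and tolerance ε ∈ (0, 1/4)
the fraction of particles whose R-window is not two-way ε-matched, after a linear isometry, to a
window of SOME Barlow stacking barlowStacking a h s (a, h ∈ (1/2, 2), any Hägg word s) tends to 0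
(bond window [0.9649, 1] = ±1.8 %, empty shell (1, 1.1] = ratio 1.14 over the core scale).
[difficulty: XL] -/
@[route_item "route-AtomisticToContinuum-SquareWellLayerCake", crux]
def GapTwelveToBarlow : Prop :=
  ∀ x : (N : ℕ) → (Fin N → EuclideanSpace ℝ (Fin 3)), (∀ N, Literature.MathematicalPhysics.StatisticalMechanics.IsGroundState Literature.MathematicalPhysics.StatisticalMechanics.lennardJones (x N)) → Filter.Tendsto (fun N : ℕ => (Nat.card {i : Fin N // ¬ ((∀ j : Fin N, dist (x N i) (x N j) ≤ 11 / 10 → ∀ k : Fin N, k ≠ j → (55 : ℝ) / 57 ≤ dist (x N j) (x N k)) ∧ (Finset.univ.filter fun j : Fin N => j ≠ i ∧ dist (x N i) (x N j) ≤ 1).card = 12 ∧ (Finset.univ.filter fun j : Fin N => j ≠ i ∧ dist (x N i) (x N j) ≤ 11 / 10).card ≤ 12)} : ℝ) / N) Filter.atTop (nhds 0) → ∀ R ε : ℝ, 0 < R → 0 < ε → ε < 1 / 4 → Filter.Tendsto (fun N : ℕ => (Nat.card {i : Fin N // ¬ (∃ a h : ℝ, 1 / 2 < a ∧ a < 2 ∧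 1 / 2 < h ∧ h < 2 ∧ ∃ s : ℤ → ℤ, Literature.MathematicalPhysics.StatisticalMechanics.IsHaggSeq s ∧ ∃ z ∈ Literature.MathematicalPhysics.StatisticalMechanics.barlowStacking a h s, ∃ A : EuclideanSpace ℝ (Fin 3) →ₗᵢ[ℝ] EuclideanSpace ℝ (Fin 3), (∀ p ∈ Literature.MathematicalPhysics.StatisticalMechanics.barlowStacking a h s, dist p z ≤ R → ∃ j : Fin N, dist (x N j) (x N i + A (p - z)) ≤ ε) ∧ (∀ j : Fin N, dist (x N j) (x N i) ≤ R → ∃ p ∈ Literature.MathematicalPhysics.StatisticalMechanics.barlowStacking a h s, dist (x N j) (x N i + A (p - z)) ≤ ε))} : ℝ) / N) Filter.atTop (nhds 0)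

/-- item stmt-AtomisticToContinuum-15808 · crux · rank 4 · open · by planner
why it might fail: fails iff LJ bulk ground states carry a positive density of sites with ≤ 11 neighbours within 1 or a bond < 55/57 = 0.9649 nearby (a* = 0.9712: margin 0.65 %); 'tail cannot subsidise a first-zone deficit' is uncertified (bcc ratio 0.55); average ⇒ per-site needs computer-assisted Tammes-13.
sources: BlancLewin2015, Blanc2004, Xue1997, MusinTarasov2012, Stillinger2001, LiebLoss2001
[crux] TWELVE WITHIN ONE, a.e. (card K2 in its consumable one-sided form): for every sequence of
Lennard-Jones ground states the fraction of particles i failing [every particle within distance 1.1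
of x_i (x_i included) has all its other distances ≥ 55/57 ∧ at least 12 particles j ≠ i with
dist(x_i, x_j) ≤ 1] tends to 0. Mechanism: layer cake ⇒ the first-zone energy is −∫_1^(1.1) V′P
exactly, K1 removes all slack above 6N pairs, so a first-zone deficit can only be subsidised by
compression or tail (bcc: deficit 0.056 vs tail gain 0.031 per site); the per-site form then follows
from the average by the Tammes-13 cap at ratio 1/0.9649 = 1.0364 < 1.0456. [difficulty: XL] -/
@[route_item "route-AtomisticToContinuum-SquareWellLayerCake", crux]
def TwelveWithinOne : Prop :=
  ∀ x : (N : ℕ) → (Fin N → EuclideanSpace ℝ (Fin 3)), (∀ N, Literature.MathematicalPhysics.StatisticalMechanics.IsGroundState Literature.MathematicalPhysics.StatisticalMechanics.lennardJones (x N)) → Filter.Tendsto (fun N : ℕ => (Nat.card {i : Fin N // ¬ ((∀ j : Fin N, dist (x N i) (x N j) ≤ 11 / 10 → ∀ k : Fin N, k ≠ j → (55 : ℝ) / 57 ≤ dist (x N j) (x N k)) ∧ 12 ≤ (Finset.univ.filter fun j : Fin N => j ≠ i ∧ dist (x N i) (x N j) ≤ 1).card)} : ℝ) / N) Filter.atTop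 (nhds 0)

/-- item stmt-AtomisticToContinuum-14296 · crux · rank 5 · open · by planner
why it might fail: needs hcp to beat every stacking extensively (Hägg domination |J₂| > Σ k|J_k|, J₂ ≈ −7e−5, uncertified) and faults not to buy surface-shape gains up to N ~ (δ_surf/|J₂|)³; an fcc-, long-period- or aperiodic-optimal LJ stacking kills it.
sources: Stillinger2001, SchwerdtfegerBurrowsSmits2021, FlatleyTheil2015, BlancLewin2015
[crux] STACKING-FAULT SPARSITY (the delegated selection step, own crux since the retired 0759 is
moot): for all R > 0, ε ∈ (0, 1/4) and every sequence of LJ ground states, the fraction of particles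
whose R-window is (R, ε)-matched to SOME Barlow stacking but to NO hcpStacking a h (a, h ∈ (1/2, 2),
after a rigid motion) tends to 0. Mechanism on file: each misaligned layer pair crossing the bulk
costs ≥ (|J₂| − Σ_(k≥3) k|J_k|)·area > 0 (Hägg domination with certified couplings — the engines of
PoissonBesselStacking / LuttingerTiszaRegistry / the period-2 chessboard) against an O(N^(2/3))
surface budget, so O(1) fault planes and o(N) faulted windows; alternative engine: periodicity of
1-D finite-range ground states (RadinSchulman1983) after truncating the exponentially small registry
couplings. [difficulty: XL] -/
@[route_item "route-AtomisticToContinuum-SquareWellLayerCake", crux]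
def StackingFaultSparsity : Prop :=
  ∀ R ε : ℝ, 0 < R → 0 < ε → ε < 1 / 4 → ∀ x : (N : ℕ) → (Fin N → EuclideanSpace ℝ (Fin 3)), (∀ N, Literature.MathematicalPhysics.StatisticalMechanics.IsGroundState Literature.MathematicalPhysics.StatisticalMechanics.lennardJones (x N)) → Filter.Tendsto (fun N : ℕ => (Nat.card {i : Fin N // (∃ a h : ℝ, 1 / 2 < a ∧ a < 2 ∧ 1 / 2 < h ∧ h < 2 ∧ ∃ s : ℤ → ℤ, Literature.MathematicalPhysics.StatisticalMechanics.IsHaggSeq s ∧ ∃ z ∈ Literature.MathematicalPhysics.StatisticalMechanics.barlowStacking a h s, ∃ A : EuclideanSpace ℝ (Fin 3) →ₗᵢ[ℝ] EuclideanSpace ℝ (Fin 3), (∀ p ∈ Literature.MathematicalPhysics.StatisticalMechanics.barlowStacking a h s, dist p z ≤ R → ∃ j : Fin N, dist (x N j) (x N i + A (p - z)) ≤ ε) ∧ (∀ j : Fin N, dist (x N j) (x N i) ≤ R → ∃ p ∈ Literature.MathematicalPhysics.StatisticalMechanics.barlowStacking a h s, dist (x N j) (x N i + A (p - z)) ≤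 ε)) ∧ ¬ (∃ a h : ℝ, 1 / 2 < a ∧ a < 2 ∧ 1 / 2 < h ∧ h < 2 ∧ ∃ z ∈ Literature.MathematicalPhysics.StatisticalMechanics.hcpStacking a h, ∃ A : EuclideanSpace ℝ (Fin 3) →ₗᵢ[ℝ] EuclideanSpace ℝ (Fin 3), (∀ p ∈ Literature.MathematicalPhysics.StatisticalMechanics.hcpStacking a h, dist p z ≤ R → ∃ j : Fin N, dist (x N j) (x N i + A (p - z)) ≤ ε) ∧ (∀ j : Fin N, dist (x N j) (x N i) ≤ R → ∃ p ∈ Literature.MathematicalPhysics.StatisticalMechanics.hcpStacking a h, dist (x N j) (x N i + A (p - z)) ≤ ε))} : ℝ) / N) Filter.atTop (nhds 0)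

/-- item stmt-AtomisticToContinuum-14292 · support · rank 9 · open · by planner
sources: BlancLewin2015, Hales2012
[target] X — for all R > 0, ε ∈ (0, 1/4) and every sequence of LJ ground states, the fraction of
particles i whose R-window is not two-way ε-matched (after x ↦ x_i + A(· − z), A a linear isometry,
z a stacking point) to barlowStacking a h s for some a, h ∈ (1/2, 2) and Hägg sequence s tends to 0
(signature of the retired item 4548, verbatim). -/
@[route_item "route-AtomisticToContinuum-SquareWellLayerCake", crux]
def LaminarBarlowWindows : Prop :=
  ∀ R ε : ℝ, 0 < R → 0 < ε → ε < 1 / 4 → ∀ x : (N : ℕ) → (Fin N → EuclideanSpace ℝ (Fin 3)), (∀ N, Literature.MathematicalPhysics.StatisticalMechanics.IsGroundState Literature.MathematicalPhysics.StatisticalMechanics.lennardJones (x N)) → Filter.Tendsto (fun N : ℕ => (Nat.card {i : Fin N // ¬ (∃ a h : ℝ, 1 / 2 < a ∧ a < 2 ∧ 1 / 2 < h ∧ h < 2 ∧ ∃ s : ℤ → ℤ, Literature.MathematicalPhysics.StatisticalMechanics.IsHaggSeq s ∧ ∃ z ∈ Literature.MathematicalPhysics.StatisticalMechanics.barlowStacking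 a h s, ∃ A : EuclideanSpace ℝ (Fin 3) →ₗᵢ[ℝ] EuclideanSpace ℝ (Fin 3), (∀ p ∈ Literature.MathematicalPhysics.StatisticalMechanics.barlowStacking a h s, dist p z ≤ R → ∃ j : Fin N, dist (x N j) (x N i + A (p - z)) ≤ ε) ∧ (∀ j : Fin N, dist (x N j) (x N i) ≤ R → ∃ p ∈ Literature.MathematicalPhysics.StatisticalMechanics.barlowStacking a h s, dist (x N j) (x N i + A (p - z)) ≤ ε))} : ℝ) / N) Filter.atTop (nhds 0)

/-- item stmt-AtomisticToContinuum-15809 · support · rank 9 · closed · proved by Summit.AtomisticToContinuum.Crystallization.Theorems.firstZoneExact_proof @ 46f752e39e67 (prover) · by planner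
sources: LiebLoss2001, BlancLewin2015
[support] FIRST ZONE EXACT (card P1, provable now): AveragedTwelve implies that for every finite
configuration and every index set G with pairwise distances ≥ 55/57 the clipped first-zone energy Σ
over pairs i < j in G at distance ≤ 1.1 of [V_LJ(max(r_ij, 1)) − V_LJ(1.1)] is at least
6·|G|·(V_LJ(1) − V_LJ(1.1)) — twelve saturated bonds per particle is the floor of the first zone,
with equality iff exactly 6|G| pairs all at r ≤ 1 (each term ≥ V(1) − V(1.1) = −0.0158 by
monotonicity of V_LJ on [1, ∞), at most 6|G| terms by AveragedTwelve at ρ = 1.1, d = 55/57).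
[difficulty: provable-now] -/
@[route_item "route-AtomisticToContinuum-SquareWellLayerCake"]
def FirstZoneExact : Prop :=
  AveragedTwelve → ∀ (N : ℕ) (x : Fin N → EuclideanSpace ℝ (Fin 3)) (G : Finset (Fin N)), (∀ i ∈ G, ∀ j ∈ G, i ≠ j → (55 : ℝ) / 57 ≤ dist (x i) (x j)) → 6 * (G.card : ℝ) * (Literature.MathematicalPhysics.StatisticalMechanics.lennardJones 1 - Literature.MathematicalPhysics.StatisticalMechanics.lennardJones (11 / 10)) ≤ ∑ i ∈ G, ∑ j ∈ G.filter (fun j => i < j ∧ dist (x i) (x j) ≤ 11 / 10), (Literature.MathematicalPhysics.StatisticalMechanics.lennardJones (max (dist (x i) (x j)) 1) - Literature.MathematicalPhysics.StatisticalMechanics.lennardJones (11 / 10))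

-- `FirstZoneExact` holds: proved by `Summit.AtomisticToContinuum.Crystallization.Theorems.firstZoneExact_proof` @ 46f752e39e67 (its module imports this route file, so no `_holds` link can be stated here).

/-- item stmt-AtomisticToContinuum-17992 · support · rank 9 · open · by planner
sources: MusinTarasov2012, doi:10.1080/10586458.2015.1022842, Summit.AtomisticToContinuum.Crystallization.Theorems.AveragedTwelveNegative.not_averagedTwelve_star, Summit.AtomisticToContinuum.Crystallization.Theorems.AveragedTwelveNegative.not_averagedTwelveAt_of_intConfig
[support] LADDER RUNG OF AveragedTwelve AT RATIO 17/16 = 1.0625 (judge-repair 2026-08-17;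
what_would_move_it: 'a proof of AveragedTwelve at any ratio > 1.06, or a certified witness below
it'): for every finite indexed configuration x, every index set G on which pairwise distances are ≥
d > 0, and every ρ ≤ (17/16)·d, the sum over i ∈ G of the number of j ∈ G, j ≠ i, with dist(x i, x
j) ≤ ρ is at most 12·|G|. 17/16 is the first dyadic ratio beyond the one-centre theorem (Tammes-13
radius R₁₃ = 1.04557, MusinTarasov2012) and below the Tammes-14 radius R₁₄ = 1.07082
(doi:10.1080/10586458.2015.1022842): pointwise at most 13 neighbours fit (radial bound cos θ ≤ 1 −
1/(2r²)), so the rung says exactly '#Z13 sites ≤ total deficit Σ(12 − Z)₊'. Special case of the crux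
(AveragedTwelve → AveragedTwelveRung in one line, planner Sketch.lean rc 0); NOT consumed by
`closes`, which applies K1 once at d = 55/57, ρ = 11/10 (ratio 57/50). Role: (a) its proof is the
tractability evidence the judge asked for; (b) it is the floor of the kill-criteria pivot — a
witness at ratio ≤ 17/16 closes the route, a witness only above it triggers 'restate K1 at the
witness-free ratio and shrink the 11/10 shell of K -/
@[route_item "route-AtomisticToContinuum-SquareWellLayerCake"]
def AveragedTwelveRung : Prop :=
  ∀ (N : ℕ) (x : Fin N → EuclideanSpace ℝ (Fin 3)) (G : Finset (Fin N)) (d ρ : ℝ), 0 < d → ρ ≤ 17 / 16 * d → (∀ i ∈ G, ∀ j ∈ G, i ≠ j → d ≤ dist (x i) (x j)) → (∑ i ∈ G, ((G.filter fun j => j ≠ i ∧ dist (x i) (x j) ≤ ρ).card : ℝ)) ≤ 12 * G.card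

/-- item stmt-AtomisticToContinuum-15810 · assembly · rank 1 · closed · proved by Summit.AtomisticToContinuum.Crystallization.Theorems.squareWellLayerCake_assembly_proof @ 5f953bcd3860 (prover) · by planner
sources: BlancLewin2015
[assembly] AveragedTwelve → TwelveWithinOne → GapTwelveToBarlow → StackingFaultSparsity →
Crystallization (the deciding theorem's type; provable now by `closes`). -/
@[route_item "route-AtomisticToContinuum-SquareWellLayerCake"]
def Assembly : Prop :=
  AveragedTwelve → TwelveWithinOne → GapTwelveToBarlow → StackingFaultSparsity → _root_.Crystallization

-- `Assembly` holds: proved by `Summit.AtomisticToContinuum.Crystallization.Theorems.squareWellLayerCake_assembly_proof` @ 5f953bcd3860 (its module imports this route file, so no `_holds` link can be stated here).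

/-! D-0027 §2.1 — DECIDING THEOREM (planner-authored via `route open/edit --closes-file`; by planner-plan-novel-AtomisticToContinuum-Crystal-ad211d65-v2- 2026-08-16T15:59:31Z):
its hypotheses are this route's items and its conclusion the sub-problem Statement (glue_lint), and it elaborates with this file. -/

@[closes "route-AtomisticToContinuum-SquareWellLayerCake"] theorem closes (hK1 : AveragedTwelve) (hK2 : TwelveWithinOne) (hK3 : GapTwelveToBarlow)
    (hS : StackingFaultSparsity) : _root_.Crystallization := by
  -- Step 1 (counting glue, K1 ∧ K2 ⇒ soft twelve with gap a.e.): for every ground-state sequence the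
  -- fraction of particles that are NOT (separated-neighbourhood ∧ exactly twelve within 1 ∧ at most twelve
  -- within 11/10) tends to zero.
  have hSoft : ∀ x : (N : ℕ) → (Fin N → EuclideanSpace ℝ (Fin 3)),
      (∀ N, Literature.MathematicalPhysics.StatisticalMechanics.IsGroundState Literature.MathematicalPhysics.StatisticalMechanics.lennardJones (x N)) →
      Filter.Tendsto (fun N : ℕ => (Nat.card {i : Fin N // ¬ ((∀ j : Fin N, dist (x N i) (x N j) ≤ 11 / 10 →
        ∀ k : Fin N, k ≠ j → (55 : ℝ) / 57 ≤ dist (x N j) (x N k)) ∧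
        (Finset.univ.filter fun j : Fin N => j ≠ i ∧ dist (x N i) (x N j) ≤ 1).card = 12 ∧
        (Finset.univ.filter fun j : Fin N => j ≠ i ∧ dist (x N i) (x N j) ≤ 11 / 10).card ≤ 12)} : ℝ) / N)
        Filter.atTop (nhds 0) := by
    intro x hx
    have h2 := hK2 x hx
    -- pointwise comparison of the two defect counts
    have hle : ∀ N : ℕ, (Nat.card {i : Fin N // ¬ ((∀ j : Fin N, dist (x N i) (x N j) ≤ 11 / 10 →
        ∀ k : Fin N, k ≠ j → (55 : ℝ) / 57 ≤ dist (x N j) (x N k)) ∧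
        (Finset.univ.filter fun j : Fin N => j ≠ i ∧ dist (x N i) (x N j) ≤ 1).card = 12 ∧
        (Finset.univ.filter fun j : Fin N => j ≠ i ∧ dist (x N i) (x N j) ≤ 11 / 10).card ≤ 12)} : ℝ) ≤
        13 * (Nat.card {i : Fin N // ¬ ((∀ j : Fin N, dist (x N i) (x N j) ≤ 11 / 10 →
        ∀ k : Fin N, k ≠ j → (55 : ℝ) / 57 ≤ dist (x N j) (x N k)) ∧
        12 ≤ (Finset.univ.filter fun j : Fin N => j ≠ i ∧ dist (x N i) (x N j) ≤ 1).card)} : ℝ) := by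
      intro N
      classical
      -- abbreviations
      set X : Fin N → EuclideanSpace ℝ (Fin 3) := x N with hXdef
      set Sep : Fin N → Prop := fun j => ∀ k : Fin N, k ≠ j → (55 : ℝ) / 57 ≤ dist (X j) (X k) with hSep
      set Nb : Fin N → Prop := fun i => ∀ j : Fin N, dist (X i) (X j) ≤ 11 / 10 → Sep j with hNb
      set A : Fin N → ℕ := fun i => (Finset.univ.filter fun j : Fin N => j ≠ i ∧ dist (X i) (X j) ≤ 1).card with hA
      set B : Fin N → ℕ := fun i => (Finset.univ.filter fun j : Fin N => j ≠ i ∧ dist (X i) (X j) ≤ 11 / 10).card with hB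
      show (Nat.card {i : Fin N // ¬ (Nb i ∧ A i = 12 ∧ B i ≤ 12)} : ℝ) ≤ 13 * (Nat.card {i : Fin N // ¬ (Nb i ∧ 12 ≤ A i)} : ℝ)
      rw [Nat.card_eq_fintype_card, Fintype.card_subtype, Nat.card_eq_fintype_card, Fintype.card_subtype]
      -- the finsets
      set Gc := Finset.univ.filter fun i : Fin N => ¬ (Nb i ∧ A i = 12 ∧ B i ≤ 12) with hGc
      set Pc := Finset.univ.filter fun i : Fin N => ¬ (Nb i ∧ 12 ≤ A i) with hPc
      set Ps := Finset.univ.filter fun i : Fin N => Nb i ∧ 12 ≤ A i with hPs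
      set Ss := Finset.univ.filter fun i : Fin N => Sep i with hSs
      set Bad := Finset.univ.filter fun i : Fin N => (Nb i ∧ 12 ≤ A i) ∧ 13 ≤ B i with hBad
      -- A ≤ B pointwise
      have hAB : ∀ i, A i ≤ B i := by
        intro i
        simp only [hA, hB]
        apply Finset.card_le_card
        intro j hj
        simp only [Finset.mem_filter, Finset.mem_univ, true_and] at hj ⊢
        exact ⟨hj.1, hj.2.trans (by norm_num)⟩
      -- (1) ¬Good ⊆ ¬Pre ∪ Bad
      have h1 : Gc ⊆ Pc ∪ Bad := by
        intro i hi
        simp only [hGc, hPc, hBad, Finset.mem_filter, Finset.mem_univ, true_and, Finset.mem_union] at hi ⊢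
        by_cases hp : Nb i ∧ 12 ≤ A i
        · right
          refine ⟨hp, ?_⟩
          by_contra hB13
          push Not at hB13
          have hBle : B i ≤ 12 := by omega
          have hAeq : A i = 12 := le_antisymm ((hAB i).trans hBle) hp.2
          exact hi ⟨hp.1, hAeq, hBle⟩
        · left; exact hp
      have h1c : Gc.card ≤ Pc.card + Bad.card := (Finset.card_le_card h1).trans (Finset.card_union_le _ _)
      -- (2) Bad.card ≤ 12 * Pc.card, by double counting with AveragedTwelve on the separated set Ss
      have hPsSs : Ps ⊆ Ss := by
        intro i hi
        simp only [hPs, hSs, Finset.mem_filter, Finset.mem_univ, true_and] at hi ⊢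
        exact hi.1 i (by rw [dist_self]; norm_num)
      -- K1 applied to Ss
      have hsep : ∀ i ∈ Ss, ∀ j ∈ Ss, i ≠ j → (55 : ℝ) / 57 ≤ dist (X i) (X j) := by
        intro i hi j _ hij
        simp only [hSs, Finset.mem_filter, Finset.mem_univ, true_and] at hi
        exact hi j (Ne.symm hij)
      have hK1' := hK1 N X Ss (55 / 57) (11 / 10) (by norm_num) (by norm_num) hsep
      -- C i := count inside Ss
      set C : Fin N → ℕ := fun i => (Ss.filter fun j : Fin N => j ≠ i ∧ dist (X i) (X j) ≤ 11 / 10).card with hC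
      have hBC : ∀ i ∈ Ps, B i ≤ C i := by
        intro i hi
        simp only [hPs, Finset.mem_filter, Finset.mem_univ, true_and] at hi
        simp only [hB, hC]
        apply Finset.card_le_card
        intro j hj
        simp only [Finset.mem_filter, Finset.mem_univ, true_and, hSs] at hj ⊢
        exact ⟨hi.1 j hj.2, hj.1, hj.2⟩
      -- lower bound on the sum over Ps
      have hlow : (Bad.card : ℝ) + 12 * Ps.card ≤ ∑ i ∈ Ps, (B i : ℝ) := by
        have hBadPs : Bad = Ps.filter fun i => 13 ≤ B i := by
          simp only [hBad, hPs, Finset.filter_filter]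
        have hsum1 : (Bad.card : ℝ) = ∑ i ∈ Ps, (if 13 ≤ B i then (1 : ℝ) else 0) := by
          rw [Finset.sum_boole, hBadPs]
        have hsum2 : (12 : ℝ) * Ps.card = ∑ i ∈ Ps, (12 : ℝ) := by
          rw [Finset.sum_const, nsmul_eq_mul, mul_comm]
        rw [hsum1, hsum2, ← Finset.sum_add_distrib]
        apply Finset.sum_le_sum
        intro i hi
        simp only [hPs, Finset.mem_filter, Finset.mem_univ, true_and] at hi
        have h12 : 12 ≤ B i := hi.2.trans (hAB i)
        split_ifs with h13
        · have : (13 : ℝ) ≤ B i := by exact_mod_cast h13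
          linarith
        · have : (12 : ℝ) ≤ B i := by exact_mod_cast h12
          linarith
      -- upper bound on the sum over Ps via K1
      have hup : ∑ i ∈ Ps, (B i : ℝ) ≤ 12 * Ss.card := by
        calc ∑ i ∈ Ps, (B i : ℝ) ≤ ∑ i ∈ Ps, (C i : ℝ) := by
              apply Finset.sum_le_sum
              intro i hi
              exact_mod_cast hBC i hi
          _ ≤ ∑ i ∈ Ss, (C i : ℝ) := by
              apply Finset.sum_le_sum_of_subset_of_nonneg hPsSs
              intro i _ _
              positivity
          _ ≤ 12 * Ss.card := by simpa [hC] using hK1'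
      -- Ss.card ≤ Ps.card + Pc.card (= N)
      have hSsN : (Ss.card : ℝ) ≤ Ps.card + Pc.card := by
        have hN : Ps.card + Pc.card = Fintype.card (Fin N) := by
          simp only [hPs, hPc]
          exact Finset.card_filter_add_card_filter_not _
        have : Ss.card ≤ Fintype.card (Fin N) := Finset.card_le_univ _
        exact_mod_cast (this.trans hN.ge)
      have h2c : (Bad.card : ℝ) ≤ 12 * Pc.card := by nlinarith [hlow, hup, hSsN]
      have h1c' : (Gc.card : ℝ) ≤ Pc.card + Bad.card := by exact_mod_cast h1c
      linarith
    have h13 : Filter.Tendsto (fun N : ℕ => 13 * ((Nat.card {i : Fin N // ¬ ((∀ j : Fin N, dist (x N i) (x N j) ≤ 11 / 10 →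
        ∀ k : Fin N, k ≠ j → (55 : ℝ) / 57 ≤ dist (x N j) (x N k)) ∧
        12 ≤ (Finset.univ.filter fun j : Fin N => j ≠ i ∧ dist (x N i) (x N j) ≤ 1).card)} : ℝ) / N))
        Filter.atTop (nhds 0) := by
      simpa using h2.const_mul 13
    refine squeeze_zero (fun N => by positivity) (fun N => ?_) h13
    rw [mul_div_assoc']
    exact div_le_div_of_nonneg_right (hle N) (Nat.cast_nonneg N)
  -- Step 2: K3 turns soft twelve with gap into Barlow windows a.e. (the X of route LaminarSixThreeThree)
  have hLBW : Summit.AtomisticToContinuum.Crystallization.Theses.LaminarSixThreeThree.LaminarBarlowWindows := by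
    intro R ε hR hε hε' x hx
    exact hK3 x hx (hSoft x hx) R ε hR hε hε'
  have hSFS : Summit.AtomisticToContinuum.Crystallization.Theses.LaminarSixThreeThree.StackingFaultSparsity := hS
  -- Step 3: proved shared glue — eventual hcp windows, one periodic configuration, hull criterion
  have hHcpW := Summit.AtomisticToContinuum.Crystallization.Theorems.barlowToHcpWindows_proof hLBW hSFS
  have hPW := Summit.AtomisticToContinuum.Crystallization.Theorems.hcpWindowsToPeriodicWindows_proof hHcpW
  have hHull := Summit.AtomisticToContinuum.Crystallization.Theorems.PrestressSplitKorn.stub_hullCriterion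
  have hpos : Literature.MathematicalPhysics.StatisticalMechanics.IsCrystallizing Literature.MathematicalPhysics.StatisticalMechanics.lennardJones 3 := hHull hPW
  -- Step 4: energetic conjunct — the periodic window of a ground-state sequence is a least-energy periodic
  -- configuration (windowOptimality_proof), its value is the infimum, and E(N)/N → ⨅ (crysEnergyLimit_proof)
  obtain ⟨x0, hx0⟩ : ∃ x : (N : ℕ) → (Fin N → EuclideanSpace ℝ (Fin 3)), ∀ N, Literature.MathematicalPhysics.StatisticalMechanics.IsGroundState Literature.MathematicalPhysics.StatisticalMechanics.lennardJones (x N) :=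
    ⟨fun N => (Literature.MathematicalPhysics.StatisticalMechanics.LennardJonesGroundStatesExist_holds N).choose, fun N => (Literature.MathematicalPhysics.StatisticalMechanics.LennardJonesGroundStatesExist_holds N).choose_spec⟩
  obtain ⟨P, hP⟩ := hPW x0 hx0
  have hleast : IsLeast (Set.range fun Q : Literature.MathematicalPhysics.StatisticalMechanics.PeriodicConfiguration 3 => Q.energyPerParticle Literature.MathematicalPhysics.StatisticalMechanics.lennardJones)
      (P.energyPerParticle Literature.MathematicalPhysics.StatisticalMechanics.lennardJones) :=
    Summit.AtomisticToContinuum.Crystallization.Theorems.windowOptimality_proof x0 hx0 P hP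
  have hinf : (⨅ Q : Literature.MathematicalPhysics.StatisticalMechanics.PeriodicConfiguration 3, Q.energyPerParticle Literature.MathematicalPhysics.StatisticalMechanics.lennardJones) = P.energyPerParticle Literature.MathematicalPhysics.StatisticalMechanics.lennardJones :=
    hleast.csInf_eq
  have hlim : Filter.Tendsto (fun N : ℕ => Literature.MathematicalPhysics.StatisticalMechanics.groundStateEnergy Literature.MathematicalPhysics.StatisticalMechanics.lennardJones 3 N / N) Filter.atTop
      (nhds (P.energyPerParticle Literature.MathematicalPhysics.StatisticalMechanics.lennardJones)) := by
    have h0 : Filter.Tendsto (fun N : ℕ => Literature.MathematicalPhysics.StatisticalMechanics.groundStateEnergy Literature.MathematicalPhysics.StatisticalMechanics.lennardJones 3 N / N) Filter.atTop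
        (nhds (⨅ Q : Literature.MathematicalPhysics.StatisticalMechanics.PeriodicConfiguration 3, Q.energyPerParticle Literature.MathematicalPhysics.StatisticalMechanics.lennardJones)) :=
      Summit.AtomisticToContinuum.Crystallization.Theorems.crysEnergyLimit_proof
    rw [hinf] at h0
    exact h0
  exact ⟨⟨P, hleast, hlim⟩, hpos⟩

end Summit.AtomisticToContinuum.Crystallization.Theses.SquareWellLayerCake
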